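import Summits.Ventures.PercRepro.Night2FatDegSide
import Summits.Ventures.PercRepro.Night2FatDegGeom

/-!
# night-2: the side line — points of `V` on and off `clF M`

In the two-planes regime with the side points `M = π₃ ∖ L` collinear:
* **`mem_clF_side_of_coplanar_of_spine_of_off`**: a line `{a, c}` with `a` on the spine and `c ∈ π₂` off the spine
  is coplanar with `M` only if `a ∈ clF M` (else `clF (insert a M) = π₃ ∌ c`);
* **`eq_of_mem_clF_pair_of_side`**: a point `f ∉ clF M` of `V` on the line through a side point `d` and a point `b` is
  `b` itself (three points of `V` on a line lie in one plane; through `d` that plane is `π₃`, and a line of `π₃`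
  through `d` lies in `clF M`);
* **`notMem_clF_side_of_plane_two`**: a point of `π₂` off the spine is off `clF M`;
* **`eq_of_mem_spine_of_mem_clF_side`**: at most one point of the spine lies in `clF M`;
* **`card_filter_clF_le_two_of_indep`**: an independent set has `≤ 2` points in a rank-`≤ 2` closure;
* **`exists_mem_notMem_clF_of_three_le_rkN`**: a set of rank `≥ 3` has a point off any line.
Paper `proofs/NIGHT-2-g35.md` §4.
-/

namespace PercRepro.Shadow

open PercRepro.ThmH PercRepro.PerFlat

variable {α : Type*} [DecidableEq α] {M : Matroid α} [M.Finite] {G : Finset α}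

/-- **A spine–off line coplanar with the side line has its spine point in `clF M`.** -/
theorem mem_clF_side_of_coplanar_of_spine_of_off (hs : ∀ e ∈ gr M, ∀ f ∈ gr M, e ≠ f → rkN M {e, f} = 2)
    {V : Finset α} (hVg : V ⊆ gr M) {R₁ : Finset α} (hR₁g : R₁ ⊆ gr M) (hR₁2 : rkN M R₁ = 2) {c₃ : α}
    (hc₃g : c₃ ∈ gr M) (hc₃ : c₃ ∉ clF M R₁)
    (hdeg₃ : rkN M (V.filter (fun e => e ∈ clF M (insert c₃ R₁) ∧ e ∉ clF M R₁)) ≤ 2)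
    (hM2 : 1 < (V.filter (fun e => e ∈ clF M (insert c₃ R₁) ∧ e ∉ clF M R₁)).card)
    {a c : α} (hag : a ∈ gr M) (ha : a ∈ clF M R₁) (hcg : c ∈ gr M) (hc : c ∉ clF M (insert c₃ R₁))
    (hcop : rkN M ({a, c} ∪ V.filter (fun e => e ∈ clF M (insert c₃ R₁) ∧ e ∉ clF M R₁)) ≤ 3) :
    a ∈ clF M (V.filter (fun e => e ∈ clF M (insert c₃ R₁) ∧ e ∉ clF M R₁)) := by
  set Mset := V.filter (fun e => e ∈ clF M (insert c₃ R₁) ∧ e ∉ clF M R₁) with hMset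
  have hMg : Mset ⊆ gr M := (Finset.filter_subset _ _).trans hVg
  by_contra haM
  -- `rk M = 2`
  obtain ⟨m, hm, m', hm', hmm'⟩ := Finset.one_lt_card.1 hM2
  have hM2' : 2 ≤ rkN M Mset := by
    have h := hs m (hMg hm) m' (hMg hm') hmm'
    have hsub : ({m, m'} : Finset α) ⊆ Mset := Finset.insert_subset hm (Finset.singleton_subset_iff.2 hm')
    have := rkN_mono (M := M) hsub
    omega
  have hMr : rkN M Mset = 2 := by omega
  have haM3 : rkN M (insert a Mset) = 3 := by rw [rkN_insert_of_notMem_clF hag haM, hMr]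
  -- `insert a M ⊆ π₃`, which has rank `3`: the two closures agree
  have hπ₃g : insert c₃ R₁ ⊆ gr M := Finset.insert_subset hc₃g hR₁g
  have hπ₃ : rkN M (insert c₃ R₁) = 3 := by rw [rkN_insert_of_notMem_clF hc₃g hc₃, hR₁2]
  have hsubπ : insert a Mset ⊆ clF M (insert c₃ R₁) := by
    intro e he
    rw [Finset.mem_insert] at he
    rcases he with rfl | he
    · exact clF_mono (Finset.subset_insert _ _) ha
    · exact (Finset.mem_filter.1 he).2.1
  have hcl : clF M (insert a Mset) = clF M (insert c₃ R₁) :=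
    clF_eq_clF_of_subset_clF_of_rkN_le hπ₃g hsubπ (by omega)
  -- `c ∈ clF (insert a M)`
  have hcin : c ∈ clF M (insert a Mset) := by
    apply mem_clF_of_rkN_insert_le hcg
    have heq : insert c (insert a Mset) = {a, c} ∪ Mset := by
      ext e
      simp only [Finset.mem_insert, Finset.mem_union, Finset.mem_singleton]
      tauto
    rw [heq, haM3]
    exact hcop
  rw [hcl] at hcin
  exact hc hcin

/-- **A line through a side point carries no point of `V` off `clF M` besides its other generator.** -/
theorem eq_of_mem_clF_pair_of_side (hs : ∀ e ∈ gr M, ∀ f ∈ gr M, e ≠ f → rkN M {e, f} = 2)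
    {V : Finset α} (hVg : V ⊆ gr M) {R₁ : Finset α} (hR₁V : R₁ ⊆ V) {c₂ c₃ : α} (hc₂V : c₂ ∈ V) (hc₃V : c₃ ∈ V)
    (hc₂ : c₂ ∉ clF M R₁) (hc₃ : c₃ ∉ clF M (insert c₂ R₁))
    (hcover : ∀ e ∈ V, e ∈ clF M (insert c₂ R₁) ∨ e ∈ clF M (insert c₃ R₁))
    {d b f : α} (hdV : d ∈ V) (hbV : b ∈ V) (hfV : f ∈ V) (hd3 : d ∈ clF M (insert c₃ R₁)) (hdL : d ∉ clF M R₁)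
    (hdb : d ≠ b) (hf : f ∈ clF M ({d, b} : Finset α))
    (hfM : f ∉ clF M (V.filter (fun e => e ∈ clF M (insert c₃ R₁) ∧ e ∉ clF M R₁))) : f = b := by
  by_contra hfb
  have hR₁g : R₁ ⊆ gr M := hR₁V.trans hVg
  have hc₂g : c₂ ∈ gr M := hVg hc₂V
  have hc₃g : c₃ ∈ gr M := hVg hc₃V
  have hdg : d ∈ gr M := hVg hdV
  have hbg : b ∈ gr M := hVg hbV
  have hfd : f ≠ d := by
    rintro rfl
    exact hfM (subset_clF_of_subset_gr ((Finset.filter_subset _ _).trans hVg)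
      (Finset.mem_filter.2 ⟨hdV, hd3, hdL⟩))
  set R : Finset α := {d, b, f} with hR
  have hRV : R ⊆ V := by
    intro e he
    rw [hR, Finset.mem_insert, Finset.mem_insert, Finset.mem_singleton] at he
    rcases he with rfl | rfl | rfl
    · exact hdV
    · exact hbV
    · exact hfV
  have hRg : R ⊆ gr M := hRV.trans hVg
  have hdbg : ({d, b} : Finset α) ⊆ gr M := Finset.insert_subset hdg (Finset.singleton_subset_iff.2 hbg)
  have hR2 : rkN M R = 2 := by
    have h1 : R ⊆ clF M ({d, b} : Finset α) := by
      intro e he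
      rw [hR, Finset.mem_insert, Finset.mem_insert, Finset.mem_singleton] at he
      rcases he with rfl | rfl | rfl
      · exact subset_clF_of_subset_gr hdbg (Finset.mem_insert_self _ _)
      · exact subset_clF_of_subset_gr hdbg (Finset.mem_insert_of_mem (Finset.mem_singleton_self _))
      · exact hf
    have h2 := rkN_mono (M := M) h1
    rw [rkN_clF, hs d hdg b hbg hdb] at h2
    have h3 : ({d, b} : Finset α) ⊆ R := by
      intro e he
      rw [Finset.mem_insert, Finset.mem_singleton] at he
      rw [hR, Finset.mem_insert, Finset.mem_insert, Finset.mem_singleton]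
      rcases he with rfl | rfl
      · exact Or.inl rfl
      · exact Or.inr (Or.inl rfl)
    have h4 := rkN_mono (M := M) h3
    rw [hs d hdg b hbg hdb] at h4
    omega
  have hR3 : 3 ≤ R.card := by
    rw [hR, Finset.card_insert_of_notMem, Finset.card_pair (Ne.symm hfb)]
    rw [Finset.mem_insert, Finset.mem_singleton, not_or]
    exact ⟨hdb, hfd.symm⟩
  have hdR : d ∈ R := by rw [hR]; exact Finset.mem_insert_self _ _
  have hRcover : ∀ e ∈ R, e ∈ clF M (insert c₂ R₁) ∨ e ∈ clF M (insert c₃ R₁) := fun e he => hcover e (hRV he)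
  have hRπ : R ⊆ clF M (insert c₃ R₁) := by
    rcases subset_plane_of_rkN_le_two_of_cover hs hRg hR2.le hR3 hRcover with h' | h'
    · exact absurd (mem_clF_of_mem_two_planes hR₁g hc₂g hc₃g hc₂ hc₃ (h' hdR) hd3) hdL
    · exact h'
  have := subset_clF_side_of_mem_side hs hVg hRV hR2 hR3 hRπ hdR hdL
  exact hfM (this (by rw [hR]; exact Finset.mem_insert_of_mem (Finset.mem_insert_of_mem (Finset.mem_singleton_self _))))

/-- **A point of `π₂` off the spine is off `clF M`.** -/
theorem notMem_clF_side_of_plane_two {V : Finset α} {R₁ : Finset α} (hR₁g : R₁ ⊆ gr M)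
    {c₂ c₃ : α} (hc₂g : c₂ ∈ gr M) (hc₃g : c₃ ∈ gr M) (hc₂ : c₂ ∉ clF M R₁) (hc₃ : c₃ ∉ clF M (insert c₂ R₁))
    {a : α} (ha2 : a ∈ clF M (insert c₂ R₁)) (haL : a ∉ clF M R₁) :
    a ∉ clF M (V.filter (fun e => e ∈ clF M (insert c₃ R₁) ∧ e ∉ clF M R₁)) := by
  intro haM
  have hMπ : V.filter (fun e => e ∈ clF M (insert c₃ R₁) ∧ e ∉ clF M R₁) ⊆ clF M (insert c₃ R₁) :=
    fun e he => (Finset.mem_filter.1 he).2.1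
  have ha3 : a ∈ clF M (insert c₃ R₁) := clF_subset_clF_of_subset_clF hMπ haM
  exact haL (mem_clF_of_mem_two_planes hR₁g hc₂g hc₃g hc₂ hc₃ ha2 ha3)

/-- **At most one point of the spine lies in `clF M`** (the side points are off the spine). -/
theorem eq_of_mem_spine_of_mem_clF_side (hs : ∀ e ∈ gr M, ∀ f ∈ gr M, e ≠ f → rkN M {e, f} = 2)
    {V : Finset α} (hVg : V ⊆ gr M) {R₁ : Finset α} (hR₁g : R₁ ⊆ gr M) (hR₁2 : rkN M R₁ = 2) {c₃ : α}
    (hdeg₃ : rkN M (V.filter (fun e => e ∈ clF M (insert c₃ R₁) ∧ e ∉ clF M R₁)) ≤ 2)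
    (hMne : (V.filter (fun e => e ∈ clF M (insert c₃ R₁) ∧ e ∉ clF M R₁)).Nonempty)
    {s s' : α} (hsg : s ∈ gr M) (hs'g : s' ∈ gr M) (hsL : s ∈ clF M R₁) (hs'L : s' ∈ clF M R₁)
    (hsM : s ∈ clF M (V.filter (fun e => e ∈ clF M (insert c₃ R₁) ∧ e ∉ clF M R₁)))
    (hs'M : s' ∈ clF M (V.filter (fun e => e ∈ clF M (insert c₃ R₁) ∧ e ∉ clF M R₁))) : s = s' := by
  by_contra hss'
  set Mset := V.filter (fun e => e ∈ clF M (insert c₃ R₁) ∧ e ∉ clF M R₁) with hMset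
  have hMg : Mset ⊆ gr M := (Finset.filter_subset _ _).trans hVg
  have hssg : ({s, s'} : Finset α) ⊆ gr M := Finset.insert_subset hsg (Finset.singleton_subset_iff.2 hs'g)
  -- `clF {s, s'} = clF R₁`
  have hsub : ({s, s'} : Finset α) ⊆ clF M R₁ := by
    intro e he
    rw [Finset.mem_insert, Finset.mem_singleton] at he
    rcases he with rfl | rfl
    · exact hsL
    · exact hs'L
  have hcl : clF M ({s, s'} : Finset α) = clF M R₁ :=
    clF_eq_clF_of_subset_clF_of_rkN_le hR₁g hsub (by rw [hR₁2, hs s hsg s' hs'g hss'])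
  -- `R₁ ⊆ clF M`
  have hR₁M : R₁ ⊆ clF M Mset := by
    have h1 : ({s, s'} : Finset α) ⊆ clF M Mset := by
      intro e he
      rw [Finset.mem_insert, Finset.mem_singleton] at he
      rcases he with rfl | rfl
      · exact hsM
      · exact hs'M
    have h2 : clF M ({s, s'} : Finset α) ⊆ clF M Mset := clF_subset_clF_of_subset_clF h1
    rw [hcl] at h2
    exact (subset_clF_of_subset_gr hR₁g).trans h2
  obtain ⟨m, hm⟩ := hMne
  have hmM : m ∈ clF M Mset := subset_clF_of_subset_gr hMg hm
  have hmL : m ∉ clF M R₁ := (Finset.mem_filter.1 hm).2.2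
  have hmg : m ∈ gr M := hMg hm
  have h3 : rkN M (insert m R₁) = 3 := by rw [rkN_insert_of_notMem_clF hmg hmL, hR₁2]
  have hsub3 : insert m R₁ ⊆ clF M Mset := Finset.insert_subset hmM hR₁M
  have := rkN_mono (M := M) hsub3
  rw [rkN_clF] at this
  omega

/-- **An independent set has at most two points in a closure of rank `≤ 2`.** -/
theorem card_filter_clF_le_two_of_indep {P X : Finset α} (hP : M.Indep (P : Set α)) (hX : rkN M X ≤ 2) :
    (P.filter (fun e => e ∈ clF M X)).card ≤ 2 := by
  have hind : M.Indep ((P.filter (fun e => e ∈ clF M X) : Finset α) : Set α) :=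
    hP.subset (by exact_mod_cast (Finset.filter_subset _ _))
  have h1 := rkN_eq_card_of_indep hind
  have h2 : rkN M (P.filter (fun e => e ∈ clF M X)) ≤ rkN M (clF M X) :=
    rkN_mono (fun e he => (Finset.mem_filter.1 he).2)
  rw [rkN_clF] at h2
  omega

/-- **A set of rank `≥ 3` has a point off any rank-`≤ 2` closure.** -/
theorem exists_mem_notMem_clF_of_three_le_rkN {S X : Finset α} (hS : 3 ≤ rkN M S) (hX : rkN M X ≤ 2) :
    ∃ a ∈ S, a ∉ clF M X := by
  by_contra h
  push Not at h
  have := rkN_mono (M := M) (show S ⊆ clF M X from h)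
  rw [rkN_clF] at this
  omega

end PercRepro.Shadow
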